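import Literature.NumberTheory.Automorphic.ArchTorusOrbitalFubini            -- ★ p840257 (V7)-FUBINI (B-p17 (g23)): (h3) `continuous_hasCompactSupport_partialOrbital`, (h4) `integral_comp_conj_archDiagTorus_eq_integral_partial`
import Literature.Analysis.Calculus.IteratedFDerivParametricIntegral         -- ★ `contDiff_integral_of_dominated_iteratedFDeriv` (Hörmander Thm. 1.1.9), `continuous_iteratedFDeriv_comp_affine_param`, `norm_iteratedFDeriv_comp_affine_le`
import Literature.Analysis.Calculus.ContDiffCompactSupportCutoff             -- ★ p840156 (V7)-cutoff (B-p17 (g23)): `exists_contDiff_hasCompactSupport_comp_eq`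
import HarnessLib

/-!
# The partial orbital integral of a smooth test function on `G′_∞ = Π_w G_w` is a smooth test function on `G_{w₀}` (ROAD-Sd (V7)-smooth;
# Hörmander Thm. 1.1.9 under the uniform compact support of Rogawski 1990 §8.3 ∕ Deitmar–Echterhoff Lemma 9.3.3)

Topic `NumberTheory/Automorphic`; namespace `Literature.NumberTheory.Automorphic.UnitaryGroup`.  THEOREMS ONLY (no `def`, no instance, no notation, no axiom,
no `sorry`).  Cell `pub/hodgecm-mathlib`, ENGINE T1 (crux H413 = `stmt-HodgeConjecture-24833`); floor-1 preparation, count-neutral, under books rows #111 (S-d) ∕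
#88 (ST-∞); brick «(V7)-SMOOTH PARTIAL ORBITAL» (LEAD F0P3a-plan (g9) WORD T8-32 (2) «=», 2026-09-01; author F0P3a-p02 (g9); map = F0P3a-p06 (g10)
`CENSUS-ROAD-Sd-letters` §1 «PER PLACE INSIDE GLOBAL» ∕ §5 (B3)).

WHY.  The limit-formula letters (C-bdry) `ArchTorusOrbitalOneSidedLimits` ∕ (J-nc) `ArchLimitFormulaNoncompactWall` (★ p840202) and p07's (B5) are stated PER PLACE for
test functions `Θ' : M_N(ℂ) → E`, `ContDiff ℝ ⊤ Θ'`, `HasCompactSupport (k ↦ Θ' ↑↑k)` on `G_{w₀}`; ★ (V7)-Fubini (h3)∕(h4) reads the GLOBAL torus orbital function of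
`f ∈ C_c(G′_∞)` as the per-place one of the PARTIAL ORBITAL INTEGRAL `f̃_{z′}` (continuous, compactly supported).  This file adds the smoothness: for `Θ` in the
global ambient-smooth currency (`Θ : M_N(L ⊗ ℝ) → E` smooth, compact support on `G′_∞`) and `z` regular at the places `w′ ≠ w₀` (NOTHING at `w₀`), `f̃_{z′}` IS the
restriction of a smooth `Θ'` on `M_N(ℂ)` with compact support on `G_{w₀}` — the binder shape of the per-place letters.
* §1 `isCompact_setOf_coe_archLocal_mem` — PROPERNESS OF `G_w ↪ M_N(ℂ)` in ANY signature (entries of `g⁻¹ = D⁻¹gᴴD` bounded with those of `g`,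
  ★ `norm_coe_inv_apply_of_mem_unitaryGroupOfForm_diagonal`; closed embedding `g ↦ (g, g⁻¹)`).
* §2 `coe_archPiEquivCM_symm_apply`, `coe_archPiEquivCM_symm_assemble` — the matrix of `e⁻¹(u)` (`e = archPiEquivCM`) has complex coordinates `(u_w)_{ij}` and no
  real ones; the matrix of the (h3)-assembled `e⁻¹(x′, (y_{w′})_{w′≠w₀})` is the INSERTION `ins(↑↑x′, ↑↑y)`, affine in the `w₀`-slot.
* §3 `contDiff_partialOrbital` — for `Θ` smooth with compact AMBIENT support and `z` regular off `w₀`, `X ↦ ∫ Θ(ins(X, (b_{w′} diag(z_{w′}) b_{w′}⁻¹)_{w′})) d(⊗ ν_{w′})` is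
  `C^∞` on `M_N(ℂ)`: the integrand is `Θ(Λ X + c(b))`, `‖Dⁿ_X‖ ≤ sup‖DⁿΘ‖·‖Λ‖ⁿ·𝟙_S(b)` with `S = Π_{w′≠w₀}{g | g diag(z_{w′}) g⁻¹ ∈ coe⁻¹π_{w′}(tsupport Θ)}` compact (§1 +
  ★ `isCompact_setOf_exists_conj_circleDiagonal_mem`), then ★ `contDiff_integral_of_dominated_iteratedFDeriv` (Hörmander Thm. 1.1.9);
  `hasCompactSupport_partialOrbital_comp_coe` — its restriction to `G_{w₀}` is supported in `coe⁻¹ π_{w₀}(tsupport Θ)`.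
* §4 `exists_contDiff_partialOrbital_eq` — THE LETTER (group currency in, per-place currency out; ★ cutoff `exists_contDiff_hasCompactSupport_comp_eq`, then §3);
  §5 `exists_contDiff_integral_comp_conj_archDiagTorus_eq` — with ★ (h4): `∫_{G′_∞} Θ ↑↑(g t(z) g⁻¹) dν = ∫_{G_{w₀}} Θ' ↑↑(x diag(z_{w₀}) x⁻¹) dν_{w₀}` (regular `z`).
HONEST LABEL: HC_CM is proved only modulo the printed citations until rung 0 closes; this file is real analysis over Mathlib and pays nothing by itself.
Tree ∕ Mathlib search: `rg "contDiff_partialOrbital|partialOrbital.*ContDiff|ContDiff.*piEquivPiSubtypeProd" Literature Summits` → 0; properness of `archLocal ↪ M_N(ℂ)`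
only for compact `U(N)` (`IwasawaDecompositionArchUnitary`); Mathlib differentiates once under `∫` (`hasFDerivAt_integral_of_dominated_of_fderiv_le`), not `ContDiff`.

## References
* [HormanderALPDO1] L. Hörmander, *The Analysis of Linear Partial Differential Operators I*, 2nd ed. (1990), Thm. 1.1.9 (`p ↦ ∫ H(a, p) dμ(a)` is smooth), Thm. 1.4.1 (cutoffs).
* [Rogawski1990] J. D. Rogawski, *Automorphic Representations of Unitary Groups in Three Variables*, Ann. of Math. Stud. 123 (1990), §8.3 p. 122 (orbital integrals
  are smooth on `T_reg`: uniform compact support), §1.9 p. 8 (`g⁻¹ = Φ⁻¹ ᵗḡ Φ`), §4.9 p. 54.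
* [DeitmarEchterhoff2014] A. Deitmar, S. Echterhoff, *Principles of Harmonic Analysis*, 2nd ed. (2014), Lemma 9.3.3 (orbital integrals of `C_c` functions).
* [BorelJacquet1979] A. Borel, H. Jacquet, *Automorphic forms and automorphic representations*, PSPM 33.1 (1979), §4.1 (`G_∞ = Π_v G(F_v)`).
-/

set_option autoImplicit false

noncomputable section

open MeasureTheory Matrix NumberField NumberField.InfinitePlace NumberField.mixedEmbedding Set Function Topology
open scoped MatrixGroups ContDiff

namespace Literature.NumberTheory.Automorphic.UnitaryGroup

variable (L : Type) [Field L] [NumberField L] [IsCMField L] (N : ℕ) (α : Fin N → L)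

/-! ## §1 Properness of `G_w ↪ M_N(ℂ)` -/

omit [NumberField L] [IsCMField L] in
/-- Elements of `G_w = U(σ_w diag α)(ℂ)` lie in `U(diag(σ_w α))(ℂ)` (`σ_w(diag α) = diag(σ_w α)`). [cite: Rogawski1990, §1.9 p. 8] -/
theorem coe_mem_unitaryGroupOfForm_diagonal_embedding (w : {w : InfinitePlace L // IsComplex w}) (g : archLocal L N (Matrix.diagonal α) w) :
    (g : GL (Fin N) ℂ) ∈ unitaryGroupOfForm (starRingEnd ℂ) (Matrix.diagonal fun i => w.1.embedding (α i)) := by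
  rw [← Matrix.diagonal_map (map_zero w.1.embedding)]; exact g.2

omit [NumberField L] [IsCMField L] in
/-- **PROPERNESS OF THE INCLUSION `G_w ↪ M_N(ℂ)` IN ANY SIGNATURE**: for `diag α` non-degenerate and `C ⊆ M_N(ℂ)` compact, `{g ∈ G_w | ↑↑g ∈ C}` is compact —
the entries of `g` are bounded on `C` and so are those of `g⁻¹ = D⁻¹ gᴴ D` (★ `norm_coe_inv_apply_of_mem_unitaryGroupOfForm_diagonal`), and `g ↦ (g, g⁻¹)` is a
closed embedding of `G_w` into `M_N(ℂ) × M_N(ℂ)`.  (No compactness of `G_w`: the statement is about the inclusion, not the group.)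
[cite: Rogawski1990, §1.9 p. 8; §8.3 p. 122] [cite: DeitmarEchterhoff2014, Lemma 9.3.3] -/
theorem isCompact_setOf_coe_archLocal_mem (w : {w : InfinitePlace L // IsComplex w}) (hα : ∀ i, α i ≠ 0)
    {C : Set (Matrix (Fin N) (Fin N) ℂ)} (hC : IsCompact C) :
    IsCompact {g : archLocal L N (Matrix.diagonal α) w | ((g : GL (Fin N) ℂ) : Matrix (Fin N) (Fin N) ℂ) ∈ C} := by
  have he : ∀ i, w.1.embedding (α i) ≠ 0 := fun i => (map_ne_zero _).mpr (hα i)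
  -- the entries are bounded on `C`
  have hfc : Continuous fun A : Matrix (Fin N) (Fin N) ℂ => ∑ k, ∑ i, ‖A k i‖ :=
    continuous_finsetSum _ fun k _ => continuous_finsetSum _ fun i _ => ((continuous_apply i).comp (continuous_apply k)).norm
  obtain ⟨R, hR⟩ := hC.exists_bound_of_continuousOn hfc.continuousOn
  have hent : ∀ A ∈ C, ∀ k i, ‖A k i‖ ≤ |R| := fun A hA k i => by
    have h1 : ‖A k i‖ ≤ ∑ i', ‖A k i'‖ := Finset.single_le_sum (f := fun i' => ‖A k i'‖) (fun _ _ => norm_nonneg _) (Finset.mem_univ i)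
    have h2 : ∑ i', ‖A k i'‖ ≤ ∑ k', ∑ i', ‖A k' i'‖ :=
      Finset.single_le_sum (f := fun k' => ∑ i', ‖A k' i'‖) (fun _ _ => Finset.sum_nonneg fun _ _ => norm_nonneg _) (Finset.mem_univ k)
    have h3 := hR A hA; rw [Real.norm_of_nonneg (Finset.sum_nonneg fun _ _ => Finset.sum_nonneg fun _ _ => norm_nonneg _)] at h3
    exact h1.trans (h2.trans (h3.trans (le_abs_self R)))
  -- the box of matrices with entries bounded by `R'`
  obtain ⟨R', hR'⟩ : ∃ R' : ℝ, R' = max |R| ((∑ j, ‖w.1.embedding (α j)‖⁻¹) * |R| * ∑ j, ‖w.1.embedding (α j)‖) := ⟨_, rfl⟩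
  have hBox : IsCompact {A : Matrix (Fin N) (Fin N) ℂ | ∀ k i, ‖A k i‖ ≤ R'} := by
    have hEq : {A : Matrix (Fin N) (Fin N) ℂ | ∀ k i, ‖A k i‖ ≤ R'} =
        ((Set.univ.pi fun (_ : Fin N) => Set.univ.pi fun (_ : Fin N) => Metric.closedBall (0 : ℂ) R') : Set (Matrix (Fin N) (Fin N) ℂ)) := by
      ext A; refine ⟨fun h k _ i _ => ?_, fun h k i => ?_⟩
      · simpa only [Metric.mem_closedBall, dist_zero_right] using h k i
      · simpa only [Metric.mem_closedBall, dist_zero_right] using h k (Set.mem_univ k) i (Set.mem_univ i)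
    rw [hEq]; exact isCompact_univ_pi fun _ => isCompact_univ_pi fun _ => isCompact_closedBall (0 : ℂ) R'
  -- the closed embedding `ψ : g ↦ (g, g⁻¹)` of `G_w` into `M_N(ℂ) × M_N(ℂ)`
  obtain ⟨ψ, hψdef⟩ : ∃ ψ : archLocal L N (Matrix.diagonal α) w → Matrix (Fin N) (Fin N) ℂ × Matrix (Fin N) (Fin N) ℂ,
      ψ = fun g : archLocal L N (Matrix.diagonal α) w => ((((g : GL (Fin N) ℂ) : Matrix (Fin N) (Fin N) ℂ)), ((((g : GL (Fin N) ℂ))⁻¹ : GL (Fin N) ℂ) : Matrix (Fin N) (Fin N) ℂ)) :=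
    ⟨_, rfl⟩
  have hψ : IsClosedEmbedding ψ := by
    have h1 : IsClosedEmbedding fun g : archLocal L N (Matrix.diagonal α) w => (g : GL (Fin N) ℂ) :=
      (isClosed_archLocal L N (Matrix.diagonal α) w).isClosedEmbedding_subtypeVal
    have h2 : IsClosedEmbedding (Units.embedProduct (Matrix (Fin N) (Fin N) ℂ)) := Units.isClosedEmbedding_embedProduct
    rw [hψdef]
    exact ((((Homeomorph.refl (Matrix (Fin N) (Fin N) ℂ)).prodCongr (@MulOpposite.opHomeomorph (Matrix (Fin N) (Fin N) ℂ) _).symm).isClosedEmbedding).comp h2).comp h1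
  -- `{g | ↑↑g ∈ C}` is closed and lies in the compact set `ψ⁻¹(Box × Box)`
  have hsub : {g : archLocal L N (Matrix.diagonal α) w | ((g : GL (Fin N) ℂ) : Matrix (Fin N) (Fin N) ℂ) ∈ C} ⊆
      ψ ⁻¹' ({A : Matrix (Fin N) (Fin N) ℂ | ∀ k i, ‖A k i‖ ≤ R'} ×ˢ {A : Matrix (Fin N) (Fin N) ℂ | ∀ k i, ‖A k i‖ ≤ R'}) := by
    intro g hg
    have hgU := coe_mem_unitaryGroupOfForm_diagonal_embedding L N α w g; rw [hψdef]
    refine ⟨fun k i => (hent _ hg k i).trans (by rw [hR']; exact le_max_left _ _), fun i k => ?_⟩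
    rw [norm_coe_inv_apply_of_mem_unitaryGroupOfForm_diagonal he hgU, hR']
    refine le_trans ?_ (le_max_right _ _)
    have hci' : ‖w.1.embedding (α i)‖⁻¹ ≤ ∑ j, ‖w.1.embedding (α j)‖⁻¹ :=
      Finset.single_le_sum (f := fun j => ‖w.1.embedding (α j)‖⁻¹) (fun j _ => inv_nonneg.mpr (norm_nonneg _)) (Finset.mem_univ i)
    have hce' : ‖w.1.embedding (α k)‖ ≤ ∑ j, ‖w.1.embedding (α j)‖ :=
      Finset.single_le_sum (f := fun j => ‖w.1.embedding (α j)‖) (fun j _ => norm_nonneg _) (Finset.mem_univ k)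
    gcongr; exact hent _ hg k i
  exact (hψ.isCompact_preimage (hBox.prod hBox)).of_isClosed_subset (hC.isClosed.preimage (Units.continuous_val.comp continuous_subtype_val)) hsub

/-! ## §2 The matrix of `e⁻¹(u)` and of the assembled element -/

/-- **The matrix of `e⁻¹(u) ∈ G′_∞`** (`e = archPiEquivCM : G′_∞ ≃ₜ* Π_w G_w`): complex coordinates `(u_w)_{ij}`, no real coordinates (a CM field has no real
place; ★ `coe_GLnMixedPiEquiv_symm_apply`, `mixedSpace_ext`). [cite: BorelJacquet1979, §4.1] -/
theorem coe_archPiEquivCM_symm_apply (H : Matrix (Fin N) (Fin N) L) (u : ∀ w : {w : InfinitePlace L // IsComplex w}, archLocal L N H w) :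
    ((((archPiEquivCM N L H).symm u : arch (↥(maximalRealSubfield L)) L (IsCMField.complexConj L) N H) : GL (Fin N) (mixedSpace L)) :
        Matrix (Fin N) (Fin N) (mixedSpace L)) =
      Matrix.of fun i j => ((0 : {w : InfinitePlace L // IsReal w} → ℝ),
        fun w : {w : InfinitePlace L // IsComplex w} => (((u w : archLocal L N H w) : GL (Fin N) ℂ) : Matrix (Fin N) (Fin N) ℂ) i j) :=
  Matrix.ext fun _ _ => mixedSpace_ext (↥(maximalRealSubfield L)) L (IsCMField.complexConj L) (IsCMField.complexConj_ne_one L)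
    (complexConj_smul_infinitePlace L) fun _ => rfl

/-- The inverse of Mathlib's `piEquivPiSubtypeProd`, read componentwise (definitional). [cite: BorelJacquet1979, §4.1] -/
theorem piEquivPiSubtypeProd_symm_apply_dite {ι : Type*} (π : ι → Type*) [∀ i, MeasurableSpace (π i)] (p : ι → Prop)
    [DecidablePred p] (a : ∀ i : Subtype p, π i) (b : ∀ i : {i // ¬ p i}, π i) (i : ι) :
    (MeasurableEquiv.piEquivPiSubtypeProd π p).symm (a, b) i = if h : p i then a ⟨i, h⟩ else b ⟨i, h⟩ := rfl

/-- The inverse of Mathlib's `piUnique` over the singleton `{w ∣ w = w₀}`, read at `w₀`. [cite: BorelJacquet1979, §4.1] -/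
theorem piUnique_symm_apply_of_eq {ι : Type*} (π : ι → Type*) [∀ i, MeasurableSpace (π i)] (i₀ : ι) (x : π i₀) (h : i₀ = i₀) :
    (MeasurableEquiv.piUnique fun i : {i // i = i₀} => π i.1).symm x ⟨i₀, h⟩ = x :=
  uniqueElim_default (α := fun i : {i // i = i₀} => π i.1) x

variable [∀ w : {w : InfinitePlace L // IsComplex w}, MeasurableSpace (archLocal L N (Matrix.diagonal α) w)]

open scoped Classical in
/-- **The matrix of the assembled element**: for `x′ ∈ G_{w₀}` and `y ∈ Π_{w′≠w₀} G_{w′}`, the matrix of `e⁻¹(x′, y)` (the (h3) assembly through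
`piEquivPiSubtypeProd (· = w₀)` and `piUnique`) is the INSERTION of `↑↑x′` at the slot `w₀` into the complex coordinates `(↑↑y_{w′})_{w′≠w₀}`.
[cite: BorelJacquet1979, §4.1] -/
theorem coe_archPiEquivCM_symm_assemble (w₀ : {w : InfinitePlace L // IsComplex w}) (x' : archLocal L N (Matrix.diagonal α) w₀)
    (y : ∀ w' : {w : {w : InfinitePlace L // IsComplex w} // ¬ w = w₀}, archLocal L N (Matrix.diagonal α) w'.1) :
    ((((archPiEquivCM N L (Matrix.diagonal α)).symm
        ((MeasurableEquiv.piEquivPiSubtypeProd (fun w : {w : InfinitePlace L // IsComplex w} => ↥(archLocal L N (Matrix.diagonal α) w)) (· = w₀)).symm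
          ((MeasurableEquiv.piUnique fun i : {w : {w : InfinitePlace L // IsComplex w} // w = w₀} => ↥(archLocal L N (Matrix.diagonal α) i.1)).symm x', y)) :
        arch (↥(maximalRealSubfield L)) L (IsCMField.complexConj L) N (Matrix.diagonal α)) : GL (Fin N) (mixedSpace L)) : Matrix (Fin N) (Fin N) (mixedSpace L)) =
      Matrix.of fun i j => ((0 : {w : InfinitePlace L // IsReal w} → ℝ), fun w : {w : InfinitePlace L // IsComplex w} =>
        if h : w = w₀ then ((x' : GL (Fin N) ℂ) : Matrix (Fin N) (Fin N) ℂ) i j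
        else (((y ⟨w, h⟩ : archLocal L N (Matrix.diagonal α) w) : GL (Fin N) ℂ) : Matrix (Fin N) (Fin N) ℂ) i j) := by
  rw [coe_archPiEquivCM_symm_apply]; refine Matrix.ext fun i j => ?_; simp only [Matrix.of_apply]
  refine Prod.ext rfl (funext fun w => ?_); dsimp only
  by_cases h : w = w₀
  · subst h
    have hu := piUnique_symm_apply_of_eq (fun j : {w : InfinitePlace L // IsComplex w} => ↥(archLocal L N (Matrix.diagonal α) j)) w x' rfl
    rw [dif_pos rfl, piEquivPiSubtypeProd_symm_apply_dite, dif_pos rfl, hu]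
  · rw [dif_neg h, piEquivPiSubtypeProd_symm_apply_dite, dif_neg h]

/-! ## §3 Differentiation under the integral sign: the partial orbital integral of an ambient test function is smooth -/

-- the scoped `L^∞`-operator norm on `M_N(ℂ)` and `M_N(L ⊗ ℝ)`, the cell's ambient-smooth convention (★ `ArchimedeanCalculus`, ★ `ArchTorusOrbitalDeriv`)
open scoped Matrix.Norms.Operator

variable [∀ w : {w : InfinitePlace L // IsComplex w}, BorelSpace (archLocal L N (Matrix.diagonal α) w)]
  [∀ w : {w : InfinitePlace L // IsComplex w}, SecondCountableTopology (archLocal L N (Matrix.diagonal α) w)]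
  [∀ w : {w : InfinitePlace L // IsComplex w}, LocallyCompactSpace (archLocal L N (Matrix.diagonal α) w)]

omit [IsCMField L] in
open scoped Classical in
/-- **(V7)-SMOOTH, AMBIENT FORM — THE PARTIAL ORBITAL INTEGRAL OF A SMOOTH COMPACTLY SUPPORTED `Θ : M_N(L ⊗ ℝ) → E` IS `C^∞` ON `M_N(ℂ)`**: for per-place Haar
measures `ν_{w′}` and torus coordinates `z` REGULAR AT THE PLACES `w′ ≠ w₀` (nothing at `w₀`), `X ↦ ∫_{Π_{w′≠w₀} G_{w′}} Θ(ins(X, (b_{w′}·diag(z_{w′})·b_{w′}⁻¹)_{w′≠w₀})) d(⊗ ν_{w′})`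
is `C^∞` (the integrand is `Θ(Λ X + c(b))`, `Λ` continuous linear; `‖Dⁿ_X‖ ≤ sup‖DⁿΘ‖·‖Λ‖ⁿ·𝟙_S(b)`, `S` the compact product of the per-place joint-properness sets over
`coe⁻¹ π_{w′}(tsupport Θ)`; differentiation under the integral sign to all orders, Hörmander Thm. 1.1.9). [cite: HormanderALPDO1, Thm. 1.1.9]
[cite: Rogawski1990, §8.3 p. 122] [cite: DeitmarEchterhoff2014, Lemma 9.3.3] -/
theorem contDiff_partialOrbital {E : Type*} [NormedAddCommGroup E] [NormedSpace ℝ E] [CompleteSpace E]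
    (νw : ∀ w : {w : InfinitePlace L // IsComplex w}, Measure (archLocal L N (Matrix.diagonal α) w)) [∀ w, (νw w).IsHaarMeasure]
    (hα : ∀ i, α i ≠ 0) (w₀ : {w : InfinitePlace L // IsComplex w})
    (Θ : Matrix (Fin N) (Fin N) (mixedSpace L) → E) (hΘ : ContDiff ℝ (⊤ : ℕ∞) Θ) (hΘc : HasCompactSupport Θ)
    {z : {w : InfinitePlace L // IsComplex w} → Fin N → Circle} (hz : ∀ w, w ≠ w₀ → Function.Injective (z w)) :
    ContDiff ℝ (⊤ : ℕ∞) fun X : Matrix (Fin N) (Fin N) ℂ =>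
      ∫ b : (∀ w' : {w : {w : InfinitePlace L // IsComplex w} // ¬ w = w₀}, archLocal L N (Matrix.diagonal α) w'.1),
        Θ (Matrix.of fun i j => ((0 : {w : InfinitePlace L // IsReal w} → ℝ), fun w : {w : InfinitePlace L // IsComplex w} =>
          if h : w = w₀ then X i j
          else (((b ⟨w, h⟩ * ⟨circleDiagonal N (z w), circleDiagonal_mem_archLocal_diagonal L N α w (z w)⟩ * (b ⟨w, h⟩)⁻¹ :
            archLocal L N (Matrix.diagonal α) w) : GL (Fin N) ℂ) : Matrix (Fin N) (Fin N) ℂ) i j))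
        ∂(Measure.pi fun w' : {w : {w : InfinitePlace L // IsComplex w} // ¬ w = w₀} => νw w'.1) := by
  -- the torus pieces and the conjugates
  set d : ∀ w : {w : InfinitePlace L // IsComplex w}, archLocal L N (Matrix.diagonal α) w :=
    fun w => ⟨circleDiagonal N (z w), circleDiagonal_mem_archLocal_diagonal L N α w (z w)⟩ with hd
  -- the affine decomposition `ins(X, b) = Λ X + c b`
  set ℓ : ℂ →ₗ[ℝ] mixedSpace L :=
    (LinearMap.inr ℝ ({w : InfinitePlace L // IsReal w} → ℝ) ({w : InfinitePlace L // IsComplex w} → ℂ)).comp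
      (LinearMap.single ℝ (fun _ : {w : InfinitePlace L // IsComplex w} => ℂ) w₀) with hℓ
  set Λ : Matrix (Fin N) (Fin N) ℂ →L[ℝ] Matrix (Fin N) (Fin N) (mixedSpace L) := LinearMap.toContinuousLinearMap ℓ.mapMatrix with hΛ
  set c : (∀ w' : {w : {w : InfinitePlace L // IsComplex w} // ¬ w = w₀}, archLocal L N (Matrix.diagonal α) w'.1) →
      Matrix (Fin N) (Fin N) (mixedSpace L) := fun b =>
    Matrix.of fun i j => ((0 : {w : InfinitePlace L // IsReal w} → ℝ), fun w : {w : InfinitePlace L // IsComplex w} =>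
      if h : w = w₀ then (0 : ℂ) else (((b ⟨w, h⟩ * d w * (b ⟨w, h⟩)⁻¹ : archLocal L N (Matrix.diagonal α) w) : GL (Fin N) ℂ) : Matrix (Fin N) (Fin N) ℂ) i j)
    with hc
  have hΛij : ∀ (X : Matrix (Fin N) (Fin N) ℂ) i j, Λ X i j = ((0 : {w : InfinitePlace L // IsReal w} → ℝ), Pi.single w₀ (X i j)) := by
    intro X i j
    rw [hΛ, LinearMap.coe_toContinuousLinearMap', LinearMap.mapMatrix_apply, Matrix.map_apply, hℓ, LinearMap.comp_apply, LinearMap.inr_apply, LinearMap.coe_single]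
  have hins : ∀ (X : Matrix (Fin N) (Fin N) ℂ) (b : ∀ w' : {w : {w : InfinitePlace L // IsComplex w} // ¬ w = w₀}, archLocal L N (Matrix.diagonal α) w'.1),
      (Matrix.of fun i j => ((0 : {w : InfinitePlace L // IsReal w} → ℝ), fun w : {w : InfinitePlace L // IsComplex w} =>
          if h : w = w₀ then X i j
          else (((b ⟨w, h⟩ * ⟨circleDiagonal N (z w), circleDiagonal_mem_archLocal_diagonal L N α w (z w)⟩ * (b ⟨w, h⟩)⁻¹ :
            archLocal L N (Matrix.diagonal α) w) : GL (Fin N) ℂ) : Matrix (Fin N) (Fin N) ℂ) i j)) = Λ X + c b := by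
    intro X b; refine Matrix.ext fun i j => ?_
    rw [Matrix.add_apply, hΛij]; simp only [hc, Matrix.of_apply]; rw [Prod.mk_add_mk, add_zero]
    refine Prod.ext rfl (funext fun w => ?_); dsimp only; rw [Pi.add_apply]
    by_cases h : w = w₀
    · subst h; rw [dif_pos rfl, dif_pos rfl, Pi.single_eq_same, add_zero]
    · rw [dif_neg h, dif_neg h, Pi.single_eq_of_ne h, zero_add]
  have hfun : (fun X : Matrix (Fin N) (Fin N) ℂ =>
      ∫ b : (∀ w' : {w : {w : InfinitePlace L // IsComplex w} // ¬ w = w₀}, archLocal L N (Matrix.diagonal α) w'.1),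
        Θ (Matrix.of fun i j => ((0 : {w : InfinitePlace L // IsReal w} → ℝ), fun w : {w : InfinitePlace L // IsComplex w} =>
          if h : w = w₀ then X i j
          else (((b ⟨w, h⟩ * ⟨circleDiagonal N (z w), circleDiagonal_mem_archLocal_diagonal L N α w (z w)⟩ * (b ⟨w, h⟩)⁻¹ :
            archLocal L N (Matrix.diagonal α) w) : GL (Fin N) ℂ) : Matrix (Fin N) (Fin N) ℂ) i j))
        ∂(Measure.pi fun w' : {w : {w : InfinitePlace L // IsComplex w} // ¬ w = w₀} => νw w'.1)) =
      fun X => ∫ b, Θ (Λ X + c b) ∂(Measure.pi fun w' : {w : {w : InfinitePlace L // IsComplex w} // ¬ w = w₀} => νw w'.1) := by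
    funext X; exact integral_congr_ae (Filter.Eventually.of_forall fun b => by simp only [hins])
  rw [hfun]
  -- `c` is continuous
  have hcc : Continuous c := by
    rw [hc]; refine continuous_pi fun i => continuous_pi fun j => continuous_const.prodMk (continuous_pi fun w => ?_)
    by_cases h : w = w₀
    · simp only [dif_pos h]; exact continuous_const
    · simp only [dif_neg h]
      have h1 : Continuous fun b : (∀ w' : {w : {w : InfinitePlace L // IsComplex w} // ¬ w = w₀}, archLocal L N (Matrix.diagonal α) w'.1) => b ⟨w, h⟩ := continuous_apply _
      have h2 : Continuous fun b : (∀ w' : {w : {w : InfinitePlace L // IsComplex w} // ¬ w = w₀}, archLocal L N (Matrix.diagonal α) w'.1) =>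
          (((b ⟨w, h⟩ * d w * (b ⟨w, h⟩)⁻¹ : archLocal L N (Matrix.diagonal α) w) : GL (Fin N) ℂ) : Matrix (Fin N) (Fin N) ℂ) :=
        Units.continuous_val.comp (continuous_subtype_val.comp ((h1.mul continuous_const).mul h1.inv))
      exact (continuous_apply j).comp ((continuous_apply i).comp h2)
  -- the compact set `S` carrying the `b`-support of the integrand, for every `X`
  have hπc : ∀ w : {w : InfinitePlace L // IsComplex w}, Continuous fun M : Matrix (Fin N) (Fin N) (mixedSpace L) =>
      M.map fun x : mixedSpace L => x.2 w := fun w => continuous_id.matrix_map ((continuous_apply w).comp continuous_snd)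
  have hCw : ∀ w' : {w : {w : InfinitePlace L // IsComplex w} // ¬ w = w₀}, IsCompact {k : archLocal L N (Matrix.diagonal α) w'.1 |
      ((k : GL (Fin N) ℂ) : Matrix (Fin N) (Fin N) ℂ) ∈ (fun M : Matrix (Fin N) (Fin N) (mixedSpace L) => M.map fun x : mixedSpace L => x.2 w'.1) '' tsupport Θ} :=
    fun w' => isCompact_setOf_coe_archLocal_mem L N α w'.1 hα (hΘc.isCompact.image (hπc w'.1))
  have hSw : ∀ w' : {w : {w : InfinitePlace L // IsComplex w} // ¬ w = w₀}, IsCompact {g : archLocal L N (Matrix.diagonal α) w'.1 |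
      ∃ zz ∈ ({z w'.1} : Set (Fin N → Circle)), g * ⟨circleDiagonal N zz, circleDiagonal_mem_archLocal_diagonal L N α w'.1 zz⟩ * g⁻¹ ∈
        {k : archLocal L N (Matrix.diagonal α) w'.1 | ((k : GL (Fin N) ℂ) : Matrix (Fin N) (Fin N) ℂ) ∈
          (fun M : Matrix (Fin N) (Fin N) (mixedSpace L) => M.map fun x : mixedSpace L => x.2 w'.1) '' tsupport Θ}} := fun w' =>
    isCompact_setOf_exists_conj_circleDiagonal_mem L N α w'.1 hα isCompact_singleton (by rintro _ rfl; exact hz w'.1 w'.2) (hCw w')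
  set S : Set (∀ w' : {w : {w : InfinitePlace L // IsComplex w} // ¬ w = w₀}, archLocal L N (Matrix.diagonal α) w'.1) :=
    Set.univ.pi fun w' : {w : {w : InfinitePlace L // IsComplex w} // ¬ w = w₀} => {g : archLocal L N (Matrix.diagonal α) w'.1 |
      ∃ zz ∈ ({z w'.1} : Set (Fin N → Circle)), g * ⟨circleDiagonal N zz, circleDiagonal_mem_archLocal_diagonal L N α w'.1 zz⟩ * g⁻¹ ∈
        {k : archLocal L N (Matrix.diagonal α) w'.1 | ((k : GL (Fin N) ℂ) : Matrix (Fin N) (Fin N) ℂ) ∈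
          (fun M : Matrix (Fin N) (Fin N) (mixedSpace L) => M.map fun x : mixedSpace L => x.2 w'.1) '' tsupport Θ}} with hS
  have hSc : IsCompact S := isCompact_univ_pi hSw
  -- support control: if the integrand is non-zero at `(X, b)` then `b ∈ S`
  have hsupp : ∀ X b, Θ (Λ X + c b) ≠ 0 → b ∈ S := by
    intro X b hne
    have hmem : Λ X + c b ∈ tsupport Θ := subset_tsupport _ (Function.mem_support.mpr hne)
    intro w' _; refine ⟨z w'.1, rfl, ?_⟩
    show (((b w' * d w'.1 * (b w')⁻¹ : archLocal L N (Matrix.diagonal α) w'.1) : GL (Fin N) ℂ) : Matrix (Fin N) (Fin N) ℂ) ∈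
      (fun M : Matrix (Fin N) (Fin N) (mixedSpace L) => M.map fun x : mixedSpace L => x.2 w'.1) '' tsupport Θ
    refine ⟨Λ X + c b, hmem, Matrix.ext fun i j => ?_⟩
    dsimp only; rw [Matrix.map_apply, Matrix.add_apply, hΛij]; simp only [hc, Matrix.of_apply]
    rw [Prod.snd_add, Pi.add_apply]; dsimp only; rw [Pi.single_eq_of_ne w'.2, zero_add, dif_neg w'.2]
  -- differentiate under the integral sign, to all orders
  refine Literature.Analysis.Calculus.contDiff_integral_of_dominated_iteratedFDeriv (H := fun b X => Θ (Λ X + c b)) ?_ ?_ ?_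
  · intro b; exact hΘ.comp (Λ.contDiff.add contDiff_const)
  · intro n X; exact (Literature.Analysis.Calculus.continuous_iteratedFDeriv_comp_affine_param hΘ Λ hcc n X).aestronglyMeasurable
  · intro n
    have hn : (n : ℕ∞ω) ≤ ∞ := by exact_mod_cast le_top
    obtain ⟨M, hM⟩ := (hΘ.continuous_iteratedFDeriv hn).bounded_above_of_compact_support (hΘc.iteratedFDeriv n)
    -- a bound `C` uniform in `(b, X)` (`C = M·‖Λ‖ⁿ`, ★ `norm_iteratedFDeriv_comp_affine_le`)
    obtain ⟨C, hC⟩ : ∃ C : ℝ, ∀ b X, ‖iteratedFDeriv ℝ n (fun X : Matrix (Fin N) (Fin N) ℂ => Θ (Λ X + c b)) X‖ ≤ C :=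
      ⟨_, fun b X => (Literature.Analysis.Calculus.norm_iteratedFDeriv_comp_affine_le hΘ Λ (c b) hn X).trans
        (mul_le_mul_of_nonneg_right (hM _) (pow_nonneg (norm_nonneg _) _))⟩
    refine ⟨S.indicator fun _ => C, ?_, fun b X => ?_⟩
    · exact (integrableOn_const (hSc.measure_lt_top).ne).integrable_indicator hSc.isClosed.measurableSet
    · by_cases hb : b ∈ S
      · rw [Set.indicator_of_mem hb]; exact hC b X
      · rw [Set.indicator_of_notMem hb]; have h0 : (fun X : Matrix (Fin N) (Fin N) ℂ => Θ (Λ X + c b)) = fun _ => 0 :=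
          funext fun X => Classical.not_not.mp fun hne => hb (hsupp X b hne)
        rw [h0, iteratedFDeriv_fun_zero, Pi.zero_apply, norm_zero]

omit [IsCMField L] [∀ w : {w : InfinitePlace L // IsComplex w}, BorelSpace (archLocal L N (Matrix.diagonal α) w)]
  [∀ w : {w : InfinitePlace L // IsComplex w}, SecondCountableTopology (archLocal L N (Matrix.diagonal α) w)]
  [∀ w : {w : InfinitePlace L // IsComplex w}, LocallyCompactSpace (archLocal L N (Matrix.diagonal α) w)] in
open scoped Classical in
/-- **THE PARTIAL ORBITAL INTEGRAL OF AN AMBIENT `Θ` WITH COMPACT SUPPORT HAS COMPACT SUPPORT ON `G_{w₀}`**: if `Θ(ins(↑↑x′, ·))` is not identically zero then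
`↑↑x′ ∈ π_{w₀}(tsupport Θ)`, a compact subset of `M_N(ℂ)` whose preimage in `G_{w₀}` is compact (§1).  No regularity of `z` and no continuity of `Θ` are needed.
[cite: Rogawski1990, §8.3 p. 122] [cite: DeitmarEchterhoff2014, Lemma 9.3.3] -/
theorem hasCompactSupport_partialOrbital_comp_coe {E : Type*} [NormedAddCommGroup E] [NormedSpace ℝ E]
    (νw : ∀ w : {w : InfinitePlace L // IsComplex w}, Measure (archLocal L N (Matrix.diagonal α) w)) [∀ w, (νw w).IsHaarMeasure]
    (hα : ∀ i, α i ≠ 0) (w₀ : {w : InfinitePlace L // IsComplex w})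
    (Θ : Matrix (Fin N) (Fin N) (mixedSpace L) → E) (hΘc : HasCompactSupport Θ)
    (z : {w : InfinitePlace L // IsComplex w} → Fin N → Circle) :
    HasCompactSupport fun x' : archLocal L N (Matrix.diagonal α) w₀ =>
      ∫ b : (∀ w' : {w : {w : InfinitePlace L // IsComplex w} // ¬ w = w₀}, archLocal L N (Matrix.diagonal α) w'.1),
        Θ (Matrix.of fun i j => ((0 : {w : InfinitePlace L // IsReal w} → ℝ), fun w : {w : InfinitePlace L // IsComplex w} =>
          if h : w = w₀ then ((x' : GL (Fin N) ℂ) : Matrix (Fin N) (Fin N) ℂ) i j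
          else (((b ⟨w, h⟩ * ⟨circleDiagonal N (z w), circleDiagonal_mem_archLocal_diagonal L N α w (z w)⟩ * (b ⟨w, h⟩)⁻¹ :
            archLocal L N (Matrix.diagonal α) w) : GL (Fin N) ℂ) : Matrix (Fin N) (Fin N) ℂ) i j))
        ∂(Measure.pi fun w' : {w : {w : InfinitePlace L // IsComplex w} // ¬ w = w₀} => νw w'.1) := by
  have hπc : Continuous fun M : Matrix (Fin N) (Fin N) (mixedSpace L) => M.map fun x : mixedSpace L => x.2 w₀ :=
    continuous_id.matrix_map ((continuous_apply w₀).comp continuous_snd)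
  refine HasCompactSupport.intro (isCompact_setOf_coe_archLocal_mem L N α w₀ hα (hΘc.isCompact.image hπc)) fun x' hx' => ?_
  refine integral_eq_zero_of_ae (Filter.Eventually.of_forall fun b => ?_)
  by_contra hne
  refine hx' ⟨_, subset_tsupport _ (Function.mem_support.mpr hne), Matrix.ext fun i j => ?_⟩
  dsimp only; rw [Matrix.map_apply, Matrix.of_apply]; exact dif_pos rfl

/-! ## §4 The letter: the partial orbital integral of a global test function is a per-place test function -/

open scoped Classical in
/-- **(V7)-SMOOTH — THE PARTIAL ORBITAL INTEGRAL OF A GLOBAL TEST FUNCTION IS A PER-PLACE TEST FUNCTION.**  For `Θ : M_N(L ⊗ ℝ) → E` smooth with `g ↦ Θ ↑↑g`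
compactly supported ON `G′_∞ = U(diag α)(L⁺ ⊗ ℝ)`, per-place Haar measures `ν_{w′}` and `z` REGULAR AT THE PLACES `w′ ≠ w₀` (`z_{w₀}` may sit on a wall), there is
`Θ' : M_N(ℂ) → E`, SMOOTH, with `k ↦ Θ' ↑↑k` COMPACTLY SUPPORTED ON `G_{w₀}` — the currency of ★ `ArchTorusOrbitalOneSidedLimits` ∕ `ArchLimitFormulaNoncompactWall` — whose
restriction to `G_{w₀}` is the partial orbital integral `f̃_{z′}` of `f = (g ↦ Θ ↑↑g)` of ★ (h3) `continuous_hasCompactSupport_partialOrbital`, VERBATIM (★ cutoff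
`exists_contDiff_hasCompactSupport_comp_eq`, then §3). [cite: HormanderALPDO1, Thm. 1.1.9, Thm. 1.4.1] [cite: Rogawski1990, §8.3 p. 122] [cite: DeitmarEchterhoff2014, Lemma 9.3.3] -/
theorem exists_contDiff_partialOrbital_eq {E : Type*} [NormedAddCommGroup E] [NormedSpace ℝ E] [CompleteSpace E]
    (νw : ∀ w : {w : InfinitePlace L // IsComplex w}, Measure (archLocal L N (Matrix.diagonal α) w)) [∀ w, (νw w).IsHaarMeasure]
    (hα : ∀ i, α i ≠ 0) (w₀ : {w : InfinitePlace L // IsComplex w})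
    (Θ : Matrix (Fin N) (Fin N) (mixedSpace L) → E) (hΘ : ContDiff ℝ (⊤ : ℕ∞) Θ)
    (hΘc : HasCompactSupport fun g : arch (↥(maximalRealSubfield L)) L (IsCMField.complexConj L) N (Matrix.diagonal α) =>
      Θ ((g : GL (Fin N) (mixedSpace L)) : Matrix (Fin N) (Fin N) (mixedSpace L)))
    {z : {w : InfinitePlace L // IsComplex w} → Fin N → Circle} (hz : ∀ w, w ≠ w₀ → Function.Injective (z w)) :
    ∃ Θ' : Matrix (Fin N) (Fin N) ℂ → E, ContDiff ℝ (⊤ : ℕ∞) Θ' ∧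
      HasCompactSupport (fun k : archLocal L N (Matrix.diagonal α) w₀ => Θ' ((k : GL (Fin N) ℂ) : Matrix (Fin N) (Fin N) ℂ)) ∧
      ∀ x' : archLocal L N (Matrix.diagonal α) w₀, Θ' ((x' : GL (Fin N) ℂ) : Matrix (Fin N) (Fin N) ℂ) =
        ∫ b : (∀ w' : {w : {w : InfinitePlace L // IsComplex w} // ¬ w = w₀}, archLocal L N (Matrix.diagonal α) w'.1),
          Θ ((((archPiEquivCM N L (Matrix.diagonal α)).symm
            ((MeasurableEquiv.piEquivPiSubtypeProd (fun w : {w : InfinitePlace L // IsComplex w} => ↥(archLocal L N (Matrix.diagonal α) w)) (· = w₀)).symm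
              ((MeasurableEquiv.piUnique fun i : {w : {w : InfinitePlace L // IsComplex w} // w = w₀} => ↥(archLocal L N (Matrix.diagonal α) i.1)).symm x',
                fun w' => b w' * ⟨circleDiagonal N (z w'.1), circleDiagonal_mem_archLocal_diagonal L N α w'.1 (z w'.1)⟩ * (b w')⁻¹)) :
              arch (↥(maximalRealSubfield L)) L (IsCMField.complexConj L) N (Matrix.diagonal α)) : GL (Fin N) (mixedSpace L)) : Matrix (Fin N) (Fin N) (mixedSpace L))
          ∂(Measure.pi fun w' : {w : {w : InfinitePlace L // IsComplex w} // ¬ w = w₀} => νw w'.1) := by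
  -- cutoff: an ambient compactly supported `Θ₁` agreeing with `Θ` on the group
  have hι : Continuous fun g : arch (↥(maximalRealSubfield L)) L (IsCMField.complexConj L) N (Matrix.diagonal α) =>
      ((g : GL (Fin N) (mixedSpace L)) : Matrix (Fin N) (Fin N) (mixedSpace L)) := Units.continuous_val.comp continuous_subtype_val
  haveI : FiniteDimensional ℝ (Matrix (Fin N) (Fin N) (mixedSpace L)) := Module.Finite.matrix
  obtain ⟨Θ₁, hΘ₁, hΘ₁c, -, hΘ₁eq⟩ := Literature.Analysis.Calculus.exists_contDiff_hasCompactSupport_comp_eq hι hΘ hΘc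
  -- the smooth ambient partial orbital integral of `Θ₁`
  obtain ⟨Θ', hΘ'⟩ : ∃ Θ' : Matrix (Fin N) (Fin N) ℂ → E, Θ' = fun X : Matrix (Fin N) (Fin N) ℂ =>
      ∫ b : (∀ w' : {w : {w : InfinitePlace L // IsComplex w} // ¬ w = w₀}, archLocal L N (Matrix.diagonal α) w'.1),
        Θ₁ (Matrix.of fun i j => ((0 : {w : InfinitePlace L // IsReal w} → ℝ), fun w : {w : InfinitePlace L // IsComplex w} =>
          if h : w = w₀ then X i j
          else (((b ⟨w, h⟩ * ⟨circleDiagonal N (z w), circleDiagonal_mem_archLocal_diagonal L N α w (z w)⟩ * (b ⟨w, h⟩)⁻¹ :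
            archLocal L N (Matrix.diagonal α) w) : GL (Fin N) ℂ) : Matrix (Fin N) (Fin N) ℂ) i j))
        ∂(Measure.pi fun w' : {w : {w : InfinitePlace L // IsComplex w} // ¬ w = w₀} => νw w'.1) := ⟨_, rfl⟩
  have h1 : ContDiff ℝ (⊤ : ℕ∞) Θ' := by
    rw [hΘ']; exact contDiff_partialOrbital L N α νw hα w₀ Θ₁ hΘ₁ hΘ₁c hz
  have h2 : HasCompactSupport (fun k : archLocal L N (Matrix.diagonal α) w₀ => Θ' ((k : GL (Fin N) ℂ) : Matrix (Fin N) (Fin N) ℂ)) := by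
    rw [hΘ']; exact hasCompactSupport_partialOrbital_comp_coe L N α νw hα w₀ Θ₁ hΘ₁c z
  refine ⟨Θ', h1, h2, fun x' => ?_⟩
  rw [hΘ']; refine integral_congr_ae (Filter.Eventually.of_forall fun b => ?_)
  have hb := coe_archPiEquivCM_symm_assemble L N α w₀ x'
    (fun w' => b w' * ⟨circleDiagonal N (z w'.1), circleDiagonal_mem_archLocal_diagonal L N α w'.1 (z w'.1)⟩ * (b w')⁻¹)
  have he := hΘ₁eq ((archPiEquivCM N L (Matrix.diagonal α)).symm
    ((MeasurableEquiv.piEquivPiSubtypeProd (fun w : {w : InfinitePlace L // IsComplex w} => ↥(archLocal L N (Matrix.diagonal α) w)) (· = w₀)).symm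
      ((MeasurableEquiv.piUnique fun i : {w : {w : InfinitePlace L // IsComplex w} // w = w₀} => ↥(archLocal L N (Matrix.diagonal α) i.1)).symm x',
        fun w' => b w' * ⟨circleDiagonal N (z w'.1), circleDiagonal_mem_archLocal_diagonal L N α w'.1 (z w'.1)⟩ * (b w')⁻¹)))
  simp only [] at he ⊢; rw [← he, hb]

/-! ## §5 With (h4): the global torus orbital function is the per-place torus orbital function of the smooth `Θ'` -/

variable [MeasurableSpace (arch (↥(maximalRealSubfield L)) L (IsCMField.complexConj L) N (Matrix.diagonal α))]
  [BorelSpace (arch (↥(maximalRealSubfield L)) L (IsCMField.complexConj L) N (Matrix.diagonal α))]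

open scoped Classical in
/-- **THE GLOBAL TORUS ORBITAL FUNCTION OF A GLOBAL TEST FUNCTION IS THE PER-PLACE TORUS ORBITAL FUNCTION OF A PER-PLACE TEST FUNCTION**: for `Θ` in the global
ambient-smooth currency and `z` regular, with the product-measure convention `ν = e⁻¹_*(⊗_w ν_w)`, the `Θ'` of §4 (built from `z_{w′}`, `w′ ≠ w₀`, only) satisfies
`∫_{G′_∞} Θ ↑↑(g·t(z)·g⁻¹) dν = ∫_{G_{w₀}} Θ' ↑↑(x·diag(z_{w₀})·x⁻¹) dν_{w₀}` — the right-hand integrand is the token shape of ★ (C-bdry)∕(J-nc)∕(B5) (★ (h4)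
`integral_comp_conj_archDiagTorus_eq_integral_partial`). [cite: Rogawski1990, §8.3 p. 122] [cite: BorelJacquet1979, §4.1] [cite: HormanderALPDO1, Thm. 1.1.9] -/
theorem exists_contDiff_integral_comp_conj_archDiagTorus_eq {E : Type*} [NormedAddCommGroup E] [NormedSpace ℝ E] [CompleteSpace E]
    (νw : ∀ w : {w : InfinitePlace L // IsComplex w}, Measure (archLocal L N (Matrix.diagonal α) w)) [∀ w, (νw w).IsHaarMeasure]
    (hα : ∀ i, α i ≠ 0) (w₀ : {w : InfinitePlace L // IsComplex w})
    (Θ : Matrix (Fin N) (Fin N) (mixedSpace L) → E) (hΘ : ContDiff ℝ (⊤ : ℕ∞) Θ)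
    (hΘc : HasCompactSupport fun g : arch (↥(maximalRealSubfield L)) L (IsCMField.complexConj L) N (Matrix.diagonal α) =>
      Θ ((g : GL (Fin N) (mixedSpace L)) : Matrix (Fin N) (Fin N) (mixedSpace L)))
    {z : {w : InfinitePlace L // IsComplex w} → Fin N → Circle} (hz : ∀ w, Function.Injective (z w)) :
    ∃ Θ' : Matrix (Fin N) (Fin N) ℂ → E, ContDiff ℝ (⊤ : ℕ∞) Θ' ∧
      HasCompactSupport (fun k : archLocal L N (Matrix.diagonal α) w₀ => Θ' ((k : GL (Fin N) ℂ) : Matrix (Fin N) (Fin N) ℂ)) ∧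
      (∀ x' : archLocal L N (Matrix.diagonal α) w₀, Θ' ((x' : GL (Fin N) ℂ) : Matrix (Fin N) (Fin N) ℂ) =
        ∫ b : (∀ w' : {w : {w : InfinitePlace L // IsComplex w} // ¬ w = w₀}, archLocal L N (Matrix.diagonal α) w'.1),
          Θ ((((archPiEquivCM N L (Matrix.diagonal α)).symm
            ((MeasurableEquiv.piEquivPiSubtypeProd (fun w : {w : InfinitePlace L // IsComplex w} => ↥(archLocal L N (Matrix.diagonal α) w)) (· = w₀)).symm
              ((MeasurableEquiv.piUnique fun i : {w : {w : InfinitePlace L // IsComplex w} // w = w₀} => ↥(archLocal L N (Matrix.diagonal α) i.1)).symm x',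
                fun w' => b w' * ⟨circleDiagonal N (z w'.1), circleDiagonal_mem_archLocal_diagonal L N α w'.1 (z w'.1)⟩ * (b w')⁻¹)) :
              arch (↥(maximalRealSubfield L)) L (IsCMField.complexConj L) N (Matrix.diagonal α)) : GL (Fin N) (mixedSpace L)) : Matrix (Fin N) (Fin N) (mixedSpace L))
          ∂(Measure.pi fun w' : {w : {w : InfinitePlace L // IsComplex w} // ¬ w = w₀} => νw w'.1)) ∧
      ∫ g, Θ (((g * archDiagTorus L N α z * g⁻¹ : arch (↥(maximalRealSubfield L)) L (IsCMField.complexConj L) N (Matrix.diagonal α)) :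
          GL (Fin N) (mixedSpace L)) : Matrix (Fin N) (Fin N) (mixedSpace L)) ∂((Measure.pi νw).map (archPiEquivCM N L (Matrix.diagonal α)).symm) =
        ∫ x : archLocal L N (Matrix.diagonal α) w₀,
          Θ' (((x * ⟨circleDiagonal N (z w₀), circleDiagonal_mem_archLocal_diagonal L N α w₀ (z w₀)⟩ * x⁻¹ : archLocal L N (Matrix.diagonal α) w₀) :
            GL (Fin N) ℂ) : Matrix (Fin N) (Fin N) ℂ) ∂(νw w₀) := by
  obtain ⟨Θ', h1, h2, h3⟩ := exists_contDiff_partialOrbital_eq L N α νw hα w₀ Θ hΘ hΘc (fun w _ => hz w)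
  refine ⟨Θ', h1, h2, h3, ?_⟩
  have hΘcont : Continuous fun g : arch (↥(maximalRealSubfield L)) L (IsCMField.complexConj L) N (Matrix.diagonal α) =>
      Θ ((g : GL (Fin N) (mixedSpace L)) : Matrix (Fin N) (Fin N) (mixedSpace L)) :=
    hΘ.continuous.comp (Units.continuous_val.comp continuous_subtype_val)
  rw [integral_comp_conj_archDiagTorus_eq_integral_partial L N α νw hα w₀ _ hΘcont hΘc hz]
  exact integral_congr_ae (Filter.Eventually.of_forall fun x => (h3 _).symm)

end Literature.NumberTheory.Automorphic.UnitaryGroup
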